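import Summits.AtomisticToContinuum.BoseEinsteinCondensation.Theorems.BECInsertionCorrectorCorrectorClosureModeCountArith
import Summits.AtomisticToContinuum.BoseEinsteinCondensation.Theorems.BECInsertionCorrectorCorrectorClosureModeCountParseval
import Summits.AtomisticToContinuum.BoseEinsteinCondensation.Theorems.BECInsertionCorrectorCorrectorClosureGroundStateFrame
import Summits.AtomisticToContinuum.BoseEinsteinCondensation.Theorems.BECInsertionCorrectorCorrectorClosureChemicalPotentialBorn
import Summits.AtomisticToContinuum.BoseEinsteinCondensation.Theorems.BECGroundStateSOSPeriodicIRBoundWFVariational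
import Summits.AtomisticToContinuum.BoseEinsteinCondensation.Theorems.BECHusimiAmplitudeGasFastFractionBound
import Literature.MathematicalPhysics.QuantumManyBody.TorusFockLayer
import Literature.MathematicalPhysics.QuantumManyBody.WeightedCorrector
import HarnessLib

/-!
# Line `insertion-mode-gaussian-domination`, stub S4 `stub_modeCount` — the `d = 3` mode count
# (crux `BECInsertionCorrector.CorrectorClosure`, item stmt-AtomisticToContinuum-12058; file 3 of 3)

Supports (does not close) stmt-AtomisticToContinuum-12058. For a bounded repulsive finite-range `v` whose torus energy
is nearly convex in the particle number (`2E₀(N+1) ≤ E₀(N+2) + E₀(N) + √(ρa)/L`, the hypothesis; = stub S5 / item 9094),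
there is a window parameter `M₀ = 8√π` such that for every domination constant `B > 0` there are `ρ₄, c₁ > 0`
(`c₁ = 1/2`) with: for `0 < ρ < ρ₄`, all large `N`, `L = ((N+1)/ρ)^{1/3}`, continuous positive torus Feynman–Kac ground
states `Θ₀` (`N` bodies), `Φ₀` (`N+1` bodies), IF every mode `n ≠ 0` obeys the hole-channel Kennedy–Lieb–Shastry
inequality `n_n² ≤ b(p² + 2(N+1)‖v‖₁/L³ + μ_N n_n − μ_{N+1}(n_n+1))` for every real `b ≥ b₋(n)` (stub S1) and every
window mode `p² ≤ M₀²ρa` has removal susceptibility `b₋(n) ≤ Bρ/p⁴` (Gaussian domination, stub S3), THEN the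
tagged zero-mode occupation of `Φ₀` is `≥ c₁`.

Proof (Kennedy–Lieb–Shastry's mode count, `T = 0` continuum version; LSSY 2005 Thm 2.2 for the energy):
`Φ = (Φ₀ : ℂ)` is a periodic trial state (`stub_periodicGroundStateRegularity`, `exists_trialState_of_fk`) with
`⟨Φ, HΦ⟩ ≤ E₀(N+1, L) ≤ 8πρa(N+1)` (`periodicEnergy_le_of_isPeriodicGroundStateFK`, `periodicGroundStateEnergy_le_dilute`);
`E₀(N), E₀(N+1), E₀(N+2) < ∞` (FK witnesses; Born bound `periodicGroundStateEnergy_succ_le_add_born`), `E₀(N+1) ≤ E₀(N+2)`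
(`WF.periodicGroundStateEnergy_le_succ`), so the chemical-potential terms of S1 are `≤ η n_n`, `η = √(ρa)/L`; per window
mode S1 at `b = Bρ/p⁴` and the KLS quadratic inequality give `n_n ≤ bη + √(b p²) + √(bΛ)`, whose `d = 3` lattice sums
over `‖n‖ ≤ M₀√(ρa)L/(2π)` are `(N+1)·√ρ·K(a,B,‖v‖₁)` (`modeCount_window_total`, file `…ModeCountArith`), `≤ (N+1)/8`
for `ρ < ρ₄`; off the window `p² ≥ max(64πρa, (2π/L)²)` and the kinetic Chebyshev bound carries `≤ (N+1)/8`; Parseval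
`∑_n n_n = N+1` (`modeCount_tagged_ge`, file `…ModeCountParseval`) gives `f₀ ≥ 3/4 ≥ 1/2`. The degenerate case
`a = 0` needs no separate treatment (empty window, `E₀ = 0`). References (shape only): T. Kennedy, E. H. Lieb,
B. S. Shastry, Phys. Rev. Lett. 61 (1988) 2582, (5)–(9); E. H. Lieb, R. Seiringer, J. P. Solovej, J. Yngvason,
*The Mathematics of the Bose Gas and its Condensation* (2005), Thm 2.2.
-/

noncomputable section

open MeasureTheory Filter
open scoped ENNReal NNReal BigOperators ComplexConjugate

namespace Summit.AtomisticToContinuum.BoseEinsteinCondensation.Theorems.CorrectorClosure.InsertionModeGaussianDomination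

open Literature.MathematicalPhysics.QuantumManyBody.BoseGas
open Summit.AtomisticToContinuum.BoseEinsteinCondensation.Theorems.CorrectorClosure.GeometricMeanCorrector
  (exists_trialState_of_fk)
open Summit.AtomisticToContinuum.BoseEinsteinCondensation.Cruxes.HardCoreExtension.ThirdLawCurrentFloor
  (stub_periodicGroundStateRegularity)
open Summit.AtomisticToContinuum.BoseEinsteinCondensation.Theorems.TorusGroundState
  (periodicEnergy_le_of_isPeriodicGroundStateFK)
open Summit.AtomisticToContinuum.BoseEinsteinCondensation.Theorems.CorrectorClosure.HealingScaleKacInsertion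
  (periodicGroundStateEnergy_succ_le_add_born)
open Summit.AtomisticToContinuum.BoseEinsteinCondensation.Cruxes.PeriodicIRBound.LinearPhFloorWagner.WF
  (periodicGroundStateEnergy_le_succ)
open Summit.AtomisticToContinuum.BoseEinsteinCondensation.Theorems.CorrectorClosure.Negative (sideLength_succ_pos)
open Summit.AtomisticToContinuum.BoseEinsteinCondensation.Cruxes.StaticResponseBound.StableFractionSquareCompletion
  (b1_norm_latticeVec_sq)

/-! ### Two small facts about the box -/

/-- `E₀(N+2, L) < ∞` on a box with bounded periodised potential, from `E₀(N+1, L) < ∞` and the Born bound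
`E₀(N+2) ≤ E₀(N+1) + (N+1)L⁻³∫_cell v^per`. [folklore] -/
theorem modeCount_energy_succ_succ_ne_top {v : ℝ → ℝ≥0∞} (hv : Measurable v) {N : ℕ} {L : ℝ} (hL : 0 < L)
    {C : ℝ≥0} (hC : ∀ x, periodizedPotential v L x ≤ C)
    (hE : periodicGroundStateEnergy v (N + 1) L ≠ ⊤) : periodicGroundStateEnergy v (N + 2) L ≠ ⊤ := by
  have hborn := periodicGroundStateEnergy_succ_le_add_born v hv (N + 1) L hL
  refine ne_top_of_le_ne_top ?_ hborn
  refine ENNReal.add_ne_top.2 ⟨hE, ENNReal.mul_ne_top (ENNReal.mul_ne_top (ENNReal.natCast_ne_top _)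
    (ENNReal.inv_ne_top.2 ((ENNReal.ofReal_pos.2 (by positivity)).ne'))) ?_⟩
  refine ne_top_of_le_ne_top ?_ (setLIntegral_mono measurable_const fun x _ => hC x)
  rw [setLIntegral_const, volume_cell]
  exact ENNReal.mul_ne_top ENNReal.coe_ne_top (ENNReal.pow_ne_top ENNReal.ofReal_ne_top)

/-- Near-convexity read in `ℝ`: from `2E₁ ≤ E₂ + E₀ + ofReal η` with all energies finite and `η ≥ 0`,
`2E₁.toReal ≤ E₂.toReal + E₀.toReal + η`. [folklore] -/
theorem modeCount_toReal_convexity {E₀ E₁ E₂ : ℝ≥0∞} {η : ℝ} (h0 : E₀ ≠ ⊤) (h2 : E₂ ≠ ⊤)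
    (hη : 0 ≤ η) (h : 2 * E₁ ≤ E₂ + E₀ + ENNReal.ofReal η) :
    2 * E₁.toReal ≤ E₂.toReal + E₀.toReal + η := by
  have hfin : E₂ + E₀ + ENNReal.ofReal η ≠ ⊤ :=
    ENNReal.add_ne_top.2 ⟨ENNReal.add_ne_top.2 ⟨h2, h0⟩, ENNReal.ofReal_ne_top⟩
  have := ENNReal.toReal_mono hfin h
  rwa [ENNReal.toReal_mul, ENNReal.toReal_ofNat, ENNReal.toReal_add (ENNReal.add_ne_top.2 ⟨h2, h0⟩)
    ENNReal.ofReal_ne_top, ENNReal.toReal_add h2 h0, ENNReal.toReal_ofReal hη] at this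

/-! ### The stub -/

-- The skeleton's binders `hbdd`, `Continuous Θ₀`, `0 < Θ₀`, `Continuous Φ₀`, `0 < Φ₀` are part of the registered
-- signature but not needed by this proof; the linter is silenced for this declaration only.
set_option linter.unusedVariables false in
/-- **S4 `stub_modeCount` — the `d = 3` mode count: hole-channel KLS (real form) + Gaussian domination on the
window + near-convexity + the sum rule `Σ_n n_n = N+1` give torus BEC of the TRUE ground state, `f₀(Φ₀) ≥ c₁`.**
For every bounded repulsive finite-range `v` whose torus energy is nearly convex in `N` there is a window parameter
`M₀ > 0` (`= 8√π`) such that for every domination constant `B > 0` there are `ρ₄, c₁ > 0` (`c₁ = 1/2`) with: for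
`0 < ρ < ρ₄`, all large `N`, `L = sideLength ρ (N+1)`, the continuous positive FK ground states `Θ₀, Φ₀`, IF every
`n ≠ 0` satisfies S1's real inequality (for every real `b ≥ b₋(n)`) and every `n ≠ 0` in the window `p² ≤ M₀²ρa`
satisfies `b₋(n) ≤ Bρ/p⁴`, THEN `taggedZeroModeOccupation N L Φ₀ ≥ c₁`. Proof: Parseval in the removed coordinate,
kinetic Parseval with `⟨Φ,HΦ⟩ ≤ E₀(N+1,L) ≤ 8πρa(N+1)`, the per-mode KLS bound `n_n ≤ bη + √(b(p²+Λ))` on the window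
with `η = √(ρa)/L` from near-convexity, the `d = 3` lattice sums (`∑‖k‖_∞⁻² ≤ 96M` linear in `M`), and the kinetic
Chebyshev bound off the window. [cite: KLS1988PRL, (5)–(9)] -/
theorem stub_modeCount (v : ℝ → ℝ≥0∞) (hv : IsRepulsiveFiniteRange v) (hbdd : ∃ C : ℝ≥0, ∀ r, v r ≤ C)
    (hconv : ∃ ρ₅ : ℝ, 0 < ρ₅ ∧ ∀ ρ : ℝ, 0 < ρ → ρ < ρ₅ → ∀ᶠ N : ℕ in atTop,
      2 * periodicGroundStateEnergy v (N + 1) (sideLength ρ (N + 1)) ≤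
        periodicGroundStateEnergy v (N + 2) (sideLength ρ (N + 1)) +
          periodicGroundStateEnergy v N (sideLength ρ (N + 1)) +
          ENNReal.ofReal (Real.sqrt (ρ * (scatteringLength v).toReal) / sideLength ρ (N + 1))) :
    ∃ M₀ : ℝ, 0 < M₀ ∧ ∀ B : ℝ, 0 < B → ∃ ρ₄ : ℝ, 0 < ρ₄ ∧ ∃ c₁ : ℝ, 0 < c₁ ∧
      ∀ ρ : ℝ, 0 < ρ → ρ < ρ₄ → ∀ᶠ N : ℕ in atTop,
      ∀ (L : ℝ), L = sideLength ρ (N + 1) → (∃ C : ℝ≥0, ∀ x, periodizedPotential v L x ≤ C) →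
      ∀ (Θ₀ : Config N → ℝ), IsPeriodicGroundStateFK v L Θ₀ → Continuous Θ₀ → (∀ X, 0 < Θ₀ X) →
      ∀ (Φ₀ : Config (N + 1) → ℝ), IsPeriodicGroundStateFK v L Φ₀ → Continuous Φ₀ →
        (∀ X, 0 < Φ₀ X) →
      (∀ n : Fin 3 → ℤ, n ≠ 0 → ∀ b : ℝ, 0 ≤ b →
        hMinusOneSqW L Θ₀ (fun Y => (modeAn L (planeWaveMode L n) (fun X => (Φ₀ X : ℂ)) Y).re / Θ₀ Y) +
            hMinusOneSqW L Θ₀ (fun Y => (modeAn L (planeWaveMode L n) (fun X => (Φ₀ X : ℂ)) Y).im / Θ₀ Y) ≤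
          ENNReal.ofReal b →
        (cellOccupation (N + 1) L (planeWaveMode L n) (fun X => (Φ₀ X : ℂ))).toReal ^ 2 ≤
          b * (‖latticeVec (2 * Real.pi / L) n‖ ^ 2 + 2 * ((N : ℝ) + 1) * (∫⁻ x : Space, v ‖x‖).toReal / L ^ 3
            + ((periodicGroundStateEnergy v (N + 1) L).toReal - (periodicGroundStateEnergy v N L).toReal) *
                (cellOccupation (N + 1) L (planeWaveMode L n) (fun X => (Φ₀ X : ℂ))).toReal
            - ((periodicGroundStateEnergy v (N + 2) L).toReal
                - (periodicGroundStateEnergy v (N + 1) L).toReal) *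
                ((cellOccupation (N + 1) L (planeWaveMode L n) (fun X => (Φ₀ X : ℂ))).toReal + 1))) →
      (∀ n : Fin 3 → ℤ, n ≠ 0 →
        ‖latticeVec (2 * Real.pi / L) n‖ ^ 2 ≤ M₀ ^ 2 * ρ * (scatteringLength v).toReal →
        hMinusOneSqW L Θ₀ (fun Y => (modeAn L (planeWaveMode L n) (fun X => (Φ₀ X : ℂ)) Y).re / Θ₀ Y) +
            hMinusOneSqW L Θ₀ (fun Y => (modeAn L (planeWaveMode L n) (fun X => (Φ₀ X : ℂ)) Y).im / Θ₀ Y) ≤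
          ENNReal.ofReal (B * ρ / (‖latticeVec (2 * Real.pi / L) n‖ ^ 2) ^ 2)) →
      ENNReal.ofReal c₁ ≤ taggedZeroModeOccupation N L (fun X => (Φ₀ X : ℂ)) := by
  classical
  obtain ⟨ρ₅, hρ₅, hconv⟩ := hconv
  obtain ⟨R₁, ρ₀, hR₁, hρ₀, hdil⟩ := periodicGroundStateEnergy_le_dilute hv
  set a : ℝ := (scatteringLength v).toReal with ha_def
  have ha : 0 ≤ a := ENNReal.toReal_nonneg
  set V₁ : ℝ := (∫⁻ x : Space, v ‖x‖).toReal with hV₁_def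
  have hV₁ : 0 ≤ V₁ := ENNReal.toReal_nonneg
  -- the window parameter `M₀ = 8√π`, `M₀² = 64π`
  set M₀ : ℝ := 8 * Real.sqrt Real.pi with hM₀_def
  have hM₀ : 0 < M₀ := by positivity
  have hM₀sq : M₀ ^ 2 = 64 * Real.pi := by
    rw [hM₀_def, mul_pow, Real.sq_sqrt Real.pi_pos.le]; ring
  refine ⟨M₀, hM₀, fun B hB => ?_⟩
  -- the window constant `K(a, B, ‖v‖₁)` and the density threshold
  set K : ℝ := 12 * B * Real.sqrt a / Real.pi ^ 4 + 12 * M₀ ^ 2 * a * Real.sqrt B / Real.pi ^ 3 +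
    12 * M₀ * Real.sqrt a * Real.sqrt B * Real.sqrt (2 * V₁) / Real.pi ^ 3 with hK_def
  have hK : 0 ≤ K := by positivity
  set ρK : ℝ := (1 / (8 * K + 8)) ^ 2 with hρK_def
  have hρK : 0 < ρK := by positivity
  refine ⟨min ρ₅ (min ρ₀ ρK), lt_min hρ₅ (lt_min hρ₀ hρK), 1 / 2, by norm_num, fun ρ hρ hρlt => ?_⟩
  have hρ₅' : ρ < ρ₅ := lt_of_lt_of_le hρlt (min_le_left _ _)
  have hρ₀' : ρ ≤ ρ₀ := (lt_of_lt_of_le (lt_of_lt_of_le hρlt (min_le_right _ _)) (min_le_left _ _)).le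
  have hρK' : ρ < ρK := lt_of_lt_of_le (lt_of_lt_of_le hρlt (min_le_right _ _)) (min_le_right _ _)
  -- smallness: `√ρ (8K + 8) ≤ 1`
  have hsmall : Real.sqrt ρ * (8 * K + 8) ≤ 1 := by
    have h1 : Real.sqrt ρ ≤ 1 / (8 * K + 8) := by
      rw [← Real.sqrt_sq (by positivity : (0 : ℝ) ≤ 1 / (8 * K + 8))]
      exact Real.sqrt_le_sqrt hρK'.le
    calc Real.sqrt ρ * (8 * K + 8) ≤ 1 / (8 * K + 8) * (8 * K + 8) :=
          mul_le_mul_of_nonneg_right h1 (by positivity)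
      _ = 1 := by field_simp
  -- eventually in `N`: near-convexity, `L > 2R₁`, `N ≥ 1`
  have hevL : ∀ᶠ N : ℕ in atTop, 2 * R₁ < sideLength ρ (N + 1) :=
    ((tendsto_sideLength_atTop hρ).comp (tendsto_add_atTop_nat 1)).eventually_gt_atTop (2 * R₁)
  filter_upwards [hconv ρ hρ hρ₅', hevL, eventually_ge_atTop 1] with N hconvN hR₁N hN1 L hL_def hb Θ₀ hΘ hΘc
    hΘp Φ₀ hΦ hΦc hΦp hKLS hGD
  rw [← hL_def] at hconvN hR₁N
  -- the box
  have hL : 0 < L := by rw [hL_def]; exact sideLength_succ_pos hρ N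
  have hNr0 : (0 : ℝ) ≤ (N : ℝ) + 1 := by positivity
  have hρL : ρ * L ^ 3 = (N : ℝ) + 1 := by
    have h : ((N + 1 : ℕ) : ℝ) / sideLength ρ (N + 1) ^ 3 = ρ := div_sideLength_pow_three hρ (Nat.succ_pos N)
    rw [← hL_def, div_eq_iff (by positivity : L ^ 3 ≠ 0)] at h
    push_cast at h
    linarith
  have hdens : ((N : ℝ) + 1) / L ^ 3 = ρ := by
    rw [← hρL, mul_div_assoc, div_self (by positivity : L ^ 3 ≠ 0), mul_one]
  obtain ⟨C, hC⟩ := hb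
  -- the trial state `Φ = (Φ₀ : ℂ)` and its energy
  have hΦC1 : ContDiff ℝ 1 Φ₀ :=
    stub_periodicGroundStateRegularity (N + 1) L v (Nat.le_add_left 1 N) hL hv.1 ⟨C, hC⟩ Φ₀ hΦ
  obtain ⟨Ψ, hΨ⟩ := exists_trialState_of_fk hΦ hΦC1
  have hEΨ : periodicEnergy v Ψ ≤ periodicGroundStateEnergy v (N + 1) L :=
    periodicEnergy_le_of_isPeriodicGroundStateFK hL hv.1 hC hΦ hΦC1 Ψ hΨ
  -- finite energies, read in `ℝ`
  have h0top : periodicGroundStateEnergy v N L ≠ ⊤ := hΘ.energy_ne_top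
  have h1top : periodicGroundStateEnergy v (N + 1) L ≠ ⊤ := hΦ.energy_ne_top
  have h2top : periodicGroundStateEnergy v (N + 2) L ≠ ⊤ := modeCount_energy_succ_succ_ne_top hv.1 hL hC h1top
  set e₀ : ℝ := (periodicGroundStateEnergy v N L).toReal with he₀
  set e₁ : ℝ := (periodicGroundStateEnergy v (N + 1) L).toReal with he₁
  set e₂ : ℝ := (periodicGroundStateEnergy v (N + 2) L).toReal with he₂
  have h12 : e₁ ≤ e₂ := ENNReal.toReal_mono h2top (periodicGroundStateEnergy_le_succ hL hv.1 (N + 1))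
  have hη : 0 ≤ Real.sqrt (ρ * a) / L := by positivity
  have hconvR : 2 * e₁ ≤ e₂ + e₀ + Real.sqrt (ρ * a) / L :=
    modeCount_toReal_convexity h0top h2top hη hconvN
  -- the dilute energy bound `E₀(N+1, L) ≤ 8πρa(N+1)`
  have hE₀ : periodicGroundStateEnergy v (N + 1) L ≤ ENNReal.ofReal (8 * Real.pi * ρ * a * ((N : ℝ) + 1)) := by
    have h := hdil (N + 1) L (by omega) hL hR₁N (by push_cast; rw [hdens]; exact hρ₀')
    push_cast at h
    rwa [hdens] at h
  -- the window: `W = M₀²ρa`, `c = 2π/L`, cube radius `Mb = ⌊√W/c⌋₊`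
  set c : ℝ := 2 * Real.pi / L with hc_def
  have hc : 0 < c := by positivity
  set W : ℝ := M₀ ^ 2 * ρ * a with hW_def
  have hW0 : 0 ≤ W := by positivity
  set Mb : ℕ := ⌊Real.sqrt W / c⌋₊ with hMb_def
  set U : Finset (Fin 3 → ℤ) := Fintype.piFinset fun _ : Fin 3 => Finset.Icc (-(Mb : ℤ)) (Mb : ℤ) with hU_def
  set S : Finset (Fin 3 → ℤ) := U.filter (fun k => k ≠ 0 ∧ ‖latticeVec c k‖ ^ 2 ≤ W) with hS_def
  have hmemS : ∀ k : Fin 3 → ℤ, k ≠ 0 → ‖latticeVec c k‖ ^ 2 ≤ W → k ∈ S := by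
    intro k hk0 hkW
    refine Finset.mem_filter.2 ⟨?_, hk0, hkW⟩
    rw [b1_norm_latticeVec_sq] at hkW
    exact modeCount_mem_box_of_window hc hkW
  have hSsub : S ⊆ U.filter (fun n => 1 ≤ (Finset.univ.sup fun j => (n j).natAbs) ∧
      (Finset.univ.sup fun j => (n j).natAbs) ≤ Mb) := by
    intro k hk
    obtain ⟨hkU, hk0, -⟩ := Finset.mem_filter.1 hk
    exact Finset.mem_filter.2 ⟨hkU, one_le_supNorm_of_ne_zero hk0, modeCount_supNorm_le_of_mem_box hkU⟩
  have hMbR : (Mb : ℝ) ≤ M₀ * Real.sqrt ρ * Real.sqrt a * L / (2 * Real.pi) := by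
    have hsqW : Real.sqrt W = M₀ * Real.sqrt ρ * Real.sqrt a := by
      rw [hW_def, Real.sqrt_mul (x := M₀ ^ 2 * ρ) (by positivity) a,
        Real.sqrt_mul (x := M₀ ^ 2) (by positivity) ρ, Real.sqrt_sq hM₀.le]
    calc (Mb : ℝ) ≤ Real.sqrt W / c := Nat.floor_le (by positivity)
      _ = M₀ * Real.sqrt ρ * Real.sqrt a * L / (2 * Real.pi) := by
          rw [hsqW, hc_def]
          field_simp
  -- occupations and the per-mode KLS + Gaussian domination input on the window
  set x : (Fin 3 → ℤ) → ℝ := fun k => (cellOccupation (N + 1) L (planeWaveMode L k) (fun X => (Φ₀ X : ℂ))).toReal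
    with hx_def
  set P : (Fin 3 → ℤ) → ℝ := fun k => ‖latticeVec c k‖ ^ 2 with hP_def
  have hx0 : ∀ k ∈ S, 0 ≤ x k := fun k _ => ENNReal.toReal_nonneg
  have hPσ : ∀ k ∈ S, (2 * Real.pi / L) ^ 2 * (((Finset.univ.sup fun j => (k j).natAbs : ℕ)) : ℝ) ^ 2 ≤ P k := by
    intro k _
    show c ^ 2 * _ ≤ ‖latticeVec c k‖ ^ 2
    rw [b1_norm_latticeVec_sq]
    exact mul_le_mul_of_nonneg_left (supNorm_sq_le_nsq k) (sq_nonneg c)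
  have hkls : ∀ k ∈ S, x k ^ 2 ≤ B * ρ / P k ^ 2 *
      (P k + 2 * ((N : ℝ) + 1) * V₁ / L ^ 3 + (e₁ - e₀) * x k - (e₂ - e₁) * (x k + 1)) := by
    intro k hk
    obtain ⟨-, hk0, hkW⟩ := Finset.mem_filter.1 hk
    have hdom := hGD k hk0 hkW
    exact hKLS k hk0 (B * ρ / P k ^ 2) (by positivity) hdom
  -- the window total `≤ (N+1)/8`
  have hwin : ∑ k ∈ S, x k ≤ ((N : ℝ) + 1) / 8 :=
    modeCount_window_total U S Mb hB.le hρ.le ha hV₁ hL hM₀.le hMbR hρL hNr0 (le_refl K) hsmall h12 hconvR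
      hSsub x P hx0 hPσ hkls
  -- the dispersion floor off the window: `D = max (W, c²)`
  set d : ℝ := max W (c ^ 2) with hd_def
  have hd : 0 < d := lt_of_lt_of_le (by positivity) (le_max_right _ _)
  have hUV : ∀ k : Fin 3 → ℤ, k ≠ 0 → k ∉ S → ENNReal.ofReal d ≤ fracDispersion 2 L k := by
    intro k hk0 hkS
    rw [modeCount_fracDispersion_two_eq hL.ne' k]
    refine ENNReal.ofReal_le_ofReal (max_le ?_ ?_)
    · by_contra h
      exact hkS (hmemS k hk0 (not_le.1 h).le)
    · show c ^ 2 ≤ ‖latticeVec c k‖ ^ 2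
      rw [b1_norm_latticeVec_sq]
      have h1 : (1 : ℝ) ≤ ∑ j, ((k j : ℤ) : ℝ) ^ 2 := by
        have h := one_le_supNorm_of_ne_zero hk0
        have h' : (1 : ℝ) ≤ (((Finset.univ.sup fun j => (k j).natAbs : ℕ)) : ℝ) := by exact_mod_cast h
        have h'' : (1 : ℝ) ≤ (((Finset.univ.sup fun j => (k j).natAbs : ℕ)) : ℝ) ^ 2 := by nlinarith only [h']
        exact h''.trans (supNorm_sq_le_nsq k)
      calc c ^ 2 = c ^ 2 * 1 := (mul_one _).symm
        _ ≤ c ^ 2 * ∑ j, ((k j : ℤ) : ℝ) ^ 2 := mul_le_mul_of_nonneg_left h1 (sq_nonneg c)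
  -- the kinetic Chebyshev budget off the window: `d⁻¹ E₀(N+1) ≤ 8πρa(N+1)/(64πρa) = (N+1)/8`
  have hT : (ENNReal.ofReal d)⁻¹ * periodicEnergy v Ψ ≤ ENNReal.ofReal (((N : ℝ) + 1) / 8) := by
    calc (ENNReal.ofReal d)⁻¹ * periodicEnergy v Ψ
        ≤ (ENNReal.ofReal d)⁻¹ * ENNReal.ofReal (8 * Real.pi * ρ * a * ((N : ℝ) + 1)) := by
          gcongr; exact hEΨ.trans hE₀
      _ = ENNReal.ofReal (8 * Real.pi * ρ * a * ((N : ℝ) + 1) / d) := by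
          rw [← ENNReal.div_eq_inv_mul, ← ENNReal.ofReal_div_of_pos hd]
      _ ≤ ENNReal.ofReal (((N : ℝ) + 1) / 8) := by
          refine ENNReal.ofReal_le_ofReal ?_
          rw [div_le_iff₀ hd]
          have hWd : W ≤ d := le_max_left _ _
          rw [hW_def, hM₀sq] at hWd
          linarith only [mul_le_mul_of_nonneg_left hWd hNr0]
  -- Parseval bookkeeping: `f₀ ≥ 3/4 ≥ 1/2`
  have hIR : ∀ k ∈ S, cellOccupation (N + 1) L (planeWaveMode L k) Ψ.ψ ≤ ENNReal.ofReal (x k) := by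
    intro k _
    have hle := Ψ.cellOccupation_planeWaveMode_le hL k
    rw [hΨ] at hle ⊢
    exact (ENNReal.ofReal_toReal (ne_top_of_le_ne_top (ENNReal.natCast_ne_top _) hle)).ge
  have hmain := modeCount_tagged_ge hL v Ψ S x hx0 (D := ENNReal.ofReal d) (ENNReal.ofReal_pos.2 hd).ne'
    ENNReal.ofReal_ne_top hIR hUV hT hwin
  rw [hΨ] at hmain
  exact le_trans (ENNReal.ofReal_le_ofReal (by norm_num)) hmain

end Summit.AtomisticToContinuum.BoseEinsteinCondensation.Theorems.CorrectorClosure.InsertionModeGaussianDomination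

end
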